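/-
Copyright (c) 2026 the pub-hodgecm-mathlib formalisation cell (harness21).  Prover seat hodgecm-mathlib-F0P2-p02 (g7), topic T5 = P8
«(C♯)hol interior», row «Cc (3′) T3 CONTINUITY» (A-p19 (g19) architecture 2026-08-31T21:51:53Z), 2026-08-31.  KERNEL module: THEOREMS ONLY
(no definition, no named fact, no `sorry`, no instance, no notation).
-/
import Literature.NumberTheory.Automorphic.Liu2021.ThetaLiftFromLinePureTensor
import Literature.NumberTheory.Weil1964.AdelicThetaArchContinuity
import HarnessLib

/-!
# Node Cc (3′), brick T3: the projected theta class `Φ_∞ ↦ [Θ̃_{Φ_∞ ⊗ Φ_f}(f) ∘ ιA]` is a CONTINUOUS LINEAR MAP `𝓢(X_∞) → L²([U(H)])`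

Topic `NumberTheory/Automorphic/Liu2021`; namespace `Literature.NumberTheory.Automorphic.Liu2021`.  KERNEL: theorems only.  Cell hodgecm-mathlib
FLOOR 0, programme P2, topic T5 = P8 «(C♯)hol interior» (`F0/P2/T5a-TREE.md` §2b, node Cc = [Liu2021, Lem. D.2 (1)] at the complex places away
from `ι`; A-p19 (g19)'s Cc (3′) architecture, brick T3 «CONTINUITY»).

[Liu2021, proof of Prop. 4.13 Case 1, l. 2137–2141] reads the archimedean components of `V_π ⊆ Θ(σ)` off the theta lift; the (3′) closer of the
cell tests the functional `Φ_∞ ↦ pr_P [Θ̃_{Φ_∞ ⊗ Φ_f}(f) ∘ ιA]` against the Hermite basis of `𝓢(X_∞)` and concludes by DENSITY — which needs this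
functional to be a CONTINUOUS linear map on the Fréchet space `𝓢(X_∞)`, not merely additive and homogeneous (★ `toLp_lineThetaLift_add_left ∕
_smul_left`, `ThetaLiftFromLinePureTensor`).  The one analytic point: the tree's continuity of `Φ ↦ Θ_Φ(f)` (★ `ThetaKernelDatum.continuous_thetaLift_left`)
is continuity for Weil's THETA-INITIAL topology `WeilThetaDatum.ThetaTop` on `𝒮(𝔸^{n′})` (★ `ThetaInitialTopology`), the carrier of ★
`lineThetaKernelDatum`; the passage from the Schwartz topology of the archimedean slot to `ThetaTop` is Weil's Théorème 6 in the `Φ`-variable,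
proved in the tree by Banach–Steinhaus on the barrelled space `𝓢(X_∞)` (★ `Weil1964.continuous_toThetaTop_repWeilThetaDatum`, [Rudin1991, Thm 2.6];
[Weil1964, Chap. III n° 41, Thm 6 p. 193]) from (a) Weil's majorants `hρ` (continuity of every orbit `p ↦ Θ(ω(p)Φ)`, Lemme 5) and (b) continuity of
every slot `Φ_∞ ↦ Θ(ω(p)(Φ_∞ ⊗ Φ_f))`, which holds because every operator `ω(s_pair p) ∈ Mp(𝕎_𝔸)ᶜᵒⁿᵗ` is LF-continuous (★
`adelicMpCont.isLFContinuous_omega`, ★ `continuous_thetaDistLM_comp_tmul_of_isLFContinuous`; [Weil1964, Chap. I n° 11]).  After that, `Θ_Φ(f) ↦ Θ_Φ(f) ∘ [ιA]`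
is composition with a fixed continuous map of compact quotients (`ContinuousMap.continuous_precomp`) and `C([U(H)], ℂ) → L²([U(H)], ν)` is Mathlib's
bounded `ContinuousMap.toLp`.

* §1 (generic rank `N`, the §1 telescope of ★ `ThetaLiftFromLinePureTensor` VERBATIM):
  `continuous_thetaLift_lineThetaKernelDatum_of_slot` (any `ℂ`-linear family `Λ : E → 𝒮(𝔸^{n′})` from a barrelled space with continuous slots
  ⇒ `e ↦ Θ_{Λ e}(f) ∈ C([U(diag dV)], ℂ)` continuous), `continuous_thetaLift_lineThetaKernelDatum_tmul` (the slot `Φ_∞ ↦ Φ_∞ ⊗ Φ_f`),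
  **`exists_clm_toLp_lineThetaLift_of_slot`** ∕ **`exists_clm_toLp_lineThetaLift_tmul`** ∕ `exists_clm_toLp_lineThetaLift_piSBReindex_tmul`
  (`∃ T : 𝓢(X_∞) →L[ℂ] L²([U(H)], ν)`, `T Φ_∞ = [Θ̃_{Φ_∞ ⊗ Φ_f}(f) ∘ ιA]`, in the `Fin n′` currency of ★ `Def411WeilCarriersArchPlaceOperator` and in the
  reindexed `Fin N × Fin 1` currency of ★ `rightRegular_finAdelicToAdelic_toLp_lineThetaLift_tensor`, ★ `piSBReindex_tmul`);
* §2 the same composed with ANY continuous linear `S : L²([U(H)], ν) → X` — in particular `S = pr_P`, the (3′) closer's `T_f`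
  (`exists_clm_comp_toLp_lineThetaLift_tmul`, `exists_clm_comp_toLp_lineThetaLift_piSBReindex_tmul`).

HONEST SCOPE.  Nothing of [Liu2021] is asserted; no archimedean datum is computed; this file books nothing and discharges nothing booked (it is
brick T3 of the in-house node Cc of the booked letter (C♯)hol).  HC_CM is proved only modulo the printed citations until rung 0 closes.

## References
* [Weil1964] A. Weil, *Sur certains groupes d'opérateurs unitaires*, Acta Math. 111 (1964) 143–211: Chap. I n° 11 pp. 157–158 (continuity of
  the operators on `𝒮(X)`), Chap. III n° 41 Lemme 5 p. 192, Théorème 6 p. 193 («dépend continûment de (S, Φ)»).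
* [Rudin1991] W. Rudin, *Functional Analysis*, 2nd ed. (1991), Thm 2.6 (Banach–Steinhaus), Thm 1.32 (continuity of bounded linear maps).
* [FleigEtAl2018] P. Fleig, H. Gustafsson, A. Kleinschmidt, D. Persson, CUP (2018), §12.3 Def. 12.5 (12.37) p. 296 (the theta lift).
* [Liu2021] Y. Liu, *Fourier–Jacobi cycles and arithmetic relative trace formula*, Camb. J. Math. 9 (2021) = arXiv:2102.11518, proof of
  Prop. 4.13 Case 1 (l. 2137–2141, p. 48); App. D Lem. D.2 (1).
* [BorelJacquet1979] A. Borel, H. Jacquet, PSPM 33.1 (1979), §4.2, §4.6 (`L²(G(k)\G(𝔸))`, continuous functions on the compact quotient).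
-/

set_option autoImplicit false

noncomputable section

open NumberField MeasureTheory IsDedekindDomain
open scoped Matrix Kronecker ComplexOrder ENNReal SchwartzMap TensorProduct Classical

namespace Literature.NumberTheory.Automorphic.Liu2021

open _root_.MeasureTheory _root_.Topology
open Literature.NumberTheory.Automorphic Literature.NumberTheory.Automorphic.UnitaryGroup
open Literature.NumberTheory.Automorphic.UnitaryGroup.CotangentForms
open Literature.NumberTheory.Automorphic.IdeleClassGroup
open Literature.NumberTheory.Automorphic.Liu2021.Def411WeilCarriers
open Literature.NumberTheory.Automorphic.Liu2021.Def411WeilCarriersDoubling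
open Literature.NumberTheory.GelbartRogawski1991 Literature.NumberTheory.GelbartRogawski1991.UnitaryDualPair
open Literature.NumberTheory.Weil1964
open Literature.RepresentationTheory.Liu2021
open Literature.RepresentationTheory.CompactGroups
open Literature.RepresentationTheory.HeisenbergGroup

/-! ## §1 Continuity in the Schwartz–Bruhat variable along a linear family; the `L²`-class as a continuous linear map (generic rank `N`) -/

section Lift

variable (L : Type) [Field L] [NumberField L] [IsCMField L] (N : ℕ) (H : Matrix (Fin N) (Fin N) L)
  {n' : ℕ} (e₁ : Fin N × Fin 1 ≃ Fin n') (dV : Fin N → L) (hdV : ∀ i, IsCMField.complexConj L (dV i) = dV i)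
  (hdV0 : ∀ i, dV i ≠ 0) (g : GL (Fin N) L)
  (hg : ((g : Matrix (Fin N) (Fin N) L).map (cmConjRingHom L))ᵀ * H * (g : Matrix (Fin N) (Fin N) L) = Matrix.diagonal dV)
  (μ : Literature.NumberTheory.Automorphic.IdeleClassGroup L →ₜ* Circle) (hμ : IsConjugateSymplectic L μ) (a : (↥(maximalRealSubfield L))ˣ)
  (hρ : HasThetaMajorants fun
      (p : ↥(UnitaryGroup.adelic (↥(maximalRealSubfield L)) L (IsCMField.complexConj L) N (Matrix.diagonal dV)) × ↥(UnitaryGroup.adelic (↥(maximalRealSubfield L)) L (IsCMField.complexConj L) 1 (JW (↥(maximalRealSubfield L)) L a))) (Φ : piSchwartzBruhat (↥(maximalRealSubfield L)) (Fin n')) =>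
        pairRep (↥(maximalRealSubfield L)) L (IsCMField.complexConj L) N 1 e₁ (Matrix.diagonal dV) (JW (↥(maximalRealSubfield L)) L a)
          (chiSplittingLine L e₁ dV hdV hdV0 (toHeckeCharacter L μ) (isUnitary_toHeckeCharacter L μ)
            ((isOscillatorChar_toHeckeCharacter_iff μ).mpr hμ) (TW (↥(maximalRealSubfield L)) a)
            (isUnit_det_TW (↥(maximalRealSubfield L)) a) (JW (↥(maximalRealSubfield L)) L a) (JW_eq (↥(maximalRealSubfield L)) L a))
          p Φ)
  [CompactSpace (↥(UnitaryGroup.adelic (↥(maximalRealSubfield L)) L (IsCMField.complexConj L) N (Matrix.diagonal dV)) ⧸ (UnitaryGroup.toAdelic (↥(maximalRealSubfield L)) L (IsCMField.complexConj L) N (Matrix.diagonal dV)).range)] [MeasurableSpace (↥(UnitaryGroup.adelic (↥(maximalRealSubfield L)) L (IsCMField.complexConj L) 1 (JW (↥(maximalRealSubfield L)) L a)) ⧸ (UnitaryGroup.toAdelic (↥(maximalRealSubfield L)) L (IsCMField.complexConj L) 1 (JW (↥(maximalRealSubfield L)) L a)).range)] (μW : Measure (↥(UnitaryGroup.adelic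 (↥(maximalRealSubfield L)) L (IsCMField.complexConj L) 1 (JW (↥(maximalRealSubfield L)) L a)) ⧸ (UnitaryGroup.toAdelic (↥(maximalRealSubfield L)) L (IsCMField.complexConj L) 1 (JW (↥(maximalRealSubfield L)) L a)).range))
  (f : C((↥(UnitaryGroup.adelic (↥(maximalRealSubfield L)) L (IsCMField.complexConj L) 1 (JW (↥(maximalRealSubfield L)) L a)) ⧸ (UnitaryGroup.toAdelic (↥(maximalRealSubfield L)) L (IsCMField.complexConj L) 1 (JW (↥(maximalRealSubfield L)) L a)).range), ℂ))
  [BorelSpace (↥(UnitaryGroup.adelic (↥(maximalRealSubfield L)) L (IsCMField.complexConj L) 1 (JW (↥(maximalRealSubfield L)) L a)) ⧸ (UnitaryGroup.toAdelic (↥(maximalRealSubfield L)) L (IsCMField.complexConj L) 1 (JW (↥(maximalRealSubfield L)) L a)).range)] [IsFiniteMeasure μW]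

/-- **Weil's Théorème 6 in the `Φ`-variable, along a linear family, for the lift of the line**: if `Λ : E → 𝒮(𝔸_{L⁺}^{n′})` is `ℂ`-linear
from a barrelled space `E` and every slot `e ↦ Θ(ω(s_pair p)(Λ e))` is continuous, then `e ↦ Θ_{Λ e}(f) ∈ C([U(diag dV)], ℂ)` is continuous
(sup norm): Banach–Steinhaus gives continuity into the theta-initial carrier (★ `continuous_toThetaTop_repWeilThetaDatum`, the majorants `hρ` supply
the orbit continuity), and `Φ ↦ Θ_Φ(f)` is continuous there (★ `continuous_thetaLift_left`). [cite: Weil1964, Chap. III n° 41, Thm 6 p. 193]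
[cite: Rudin1991, Thm 2.6] -/
theorem continuous_thetaLift_lineThetaKernelDatum_of_slot
    {E : Type*} [AddCommGroup E] [Module ℂ E] [UniformSpace E] [IsUniformAddGroup E] [ContinuousSMul ℂ E] [BarrelledSpace ℂ E]
    (Λ : E →ₗ[ℂ] piSchwartzBruhat (↥(maximalRealSubfield L)) (Fin n'))
    (hΛ : ∀ p : ↥(UnitaryGroup.adelic (↥(maximalRealSubfield L)) L (IsCMField.complexConj L) N (Matrix.diagonal dV)) × ↥(UnitaryGroup.adelic (↥(maximalRealSubfield L)) L (IsCMField.complexConj L) 1 (JW (↥(maximalRealSubfield L)) L a)),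
      Continuous fun e => thetaDistLM (↥(maximalRealSubfield L)) (Fin n')
        (pairRep (↥(maximalRealSubfield L)) L (IsCMField.complexConj L) N 1 e₁ (Matrix.diagonal dV) (JW (↥(maximalRealSubfield L)) L a)
          (chiSplittingLine L e₁ dV hdV hdV0 (toHeckeCharacter L μ) (isUnitary_toHeckeCharacter L μ)
            ((isOscillatorChar_toHeckeCharacter_iff μ).mpr hμ) (TW (↥(maximalRealSubfield L)) a)
            (isUnit_det_TW (↥(maximalRealSubfield L)) a) (JW (↥(maximalRealSubfield L)) L a) (JW_eq (↥(maximalRealSubfield L)) L a))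
          p (Λ e))) :
    Continuous fun e => (lineThetaKernelDatum L N e₁ dV hdV hdV0 μ hμ a hρ).thetaLift μW (Λ e) f := by
  haveI := compactSpace_quotient_range_toAdelic_JW L a
  have h2 := (lineThetaKernelDatum L N e₁ dV hdV hdV0 μ hμ a hρ).continuous_thetaLift_left μW f
  refine h2.comp ?_
  exact continuous_toThetaTop_repWeilThetaDatum _ _ hρ Λ hΛ

/-- **The archimedean slot `Φ_∞ ↦ Θ_{Φ_∞ ⊗ Φ_f}(f) ∈ C([U(diag dV)], ℂ)` is continuous on `𝓢(X_∞)`** (`X_∞ = (L⁺ ⊗ ℝ)^{n′}`): every operator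
`ω(s_pair p) ∈ Mp(𝕎_𝔸)ᶜᵒⁿᵗ` is LF-continuous (★ `adelicMpCont.isLFContinuous_omega`), so the slots are continuous (★
`continuous_thetaDistLM_comp_tmul_of_isLFContinuous`), and `𝓢(X_∞)` is barrelled (★ `barrelledSpace_schwartzMap`).
[cite: Weil1964, Chap. I n° 11 pp. 157–158; Chap. III n° 41, Thm 6 p. 193] [cite: Rudin1991, Thm 2.6] -/
theorem continuous_thetaLift_lineThetaKernelDatum_tmul (Φf : FinSB (↥(maximalRealSubfield L)) (Fin n')) :
    Continuous fun φ : 𝓢((Fin n' → mixedEmbedding.mixedSpace ↥(maximalRealSubfield L)), ℂ) =>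
      (lineThetaKernelDatum L N e₁ dV hdV hdV0 μ hμ a hρ).thetaLift μW
        (piSchwartzBruhatEquiv (↥(maximalRealSubfield L)) (Fin n') (φ ⊗ₜ[ℂ] Φf)) f := by
  haveI : BarrelledSpace ℂ 𝓢((Fin n' → mixedEmbedding.mixedSpace ↥(maximalRealSubfield L)), ℂ) :=
    Literature.Analysis.FunctionSpaces.barrelledSpace_schwartzMap
  exact continuous_thetaLift_lineThetaKernelDatum_of_slot L N e₁ dV hdV hdV0 μ hμ a hρ μW f
    ((piSchwartzBruhatEquiv (↥(maximalRealSubfield L)) (Fin n')).toLinearMap ∘ₗ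
      (TensorProduct.mk ℂ 𝓢((Fin n' → mixedEmbedding.mixedSpace ↥(maximalRealSubfield L)), ℂ)
        (FinSB (↥(maximalRealSubfield L)) (Fin n'))).flip Φf)
    fun p => continuous_thetaDistLM_comp_tmul_of_isLFContinuous (adelicMpCont.isLFContinuous_omega _) Φf

variable [CompactSpace (adelicGroupData (↥(maximalRealSubfield L)) L (IsCMField.complexConj L) N H).automorphicQuotient]
  (ν : Measure (adelicGroupData (↥(maximalRealSubfield L)) L (IsCMField.complexConj L) N H).automorphicQuotient) [IsFiniteMeasure ν]

/-- **THE `L²`-CLASS ALONG A LINEAR FAMILY IS A CONTINUOUS LINEAR MAP.**  For a `ℂ`-linear `Λ : E → 𝒮(𝔸_{L⁺}^{n′})` from a barrelled space with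
continuous slots `e ↦ Θ(ω(s_pair p)(Λ e))`, there is a continuous linear `T : E →L[ℂ] L²([U(H)], ν)` with `T e = [Θ̃_{Λ e}(f) ∘ ιA]` for
every `e`: linearity is ★ `toLp_lineThetaLift_add_left ∕ _smul_left` (Weil's theta distribution is linear), continuity is
`continuous_thetaLift_lineThetaKernelDatum_of_slot` followed by composition with the continuous map `[x] ↦ [ιA x]` of compact quotients
(`ContinuousMap.continuous_precomp`) and by Mathlib's bounded `ContinuousMap.toLp : C([U(H)], ℂ) →L L²([U(H)], ν)`.
[cite: Weil1964, Chap. III n° 41, Thm 6 p. 193] [cite: Rudin1991, Thm 2.6] [cite: BorelJacquet1979, §4.2, §4.6] -/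
theorem exists_clm_toLp_lineThetaLift_of_slot
    {E : Type*} [AddCommGroup E] [Module ℂ E] [UniformSpace E] [IsUniformAddGroup E] [ContinuousSMul ℂ E] [BarrelledSpace ℂ E]
    (Λ : E →ₗ[ℂ] piSchwartzBruhat (↥(maximalRealSubfield L)) (Fin n'))
    (hΛ : ∀ p : ↥(UnitaryGroup.adelic (↥(maximalRealSubfield L)) L (IsCMField.complexConj L) N (Matrix.diagonal dV)) × ↥(UnitaryGroup.adelic (↥(maximalRealSubfield L)) L (IsCMField.complexConj L) 1 (JW (↥(maximalRealSubfield L)) L a)),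
      Continuous fun e => thetaDistLM (↥(maximalRealSubfield L)) (Fin n')
        (pairRep (↥(maximalRealSubfield L)) L (IsCMField.complexConj L) N 1 e₁ (Matrix.diagonal dV) (JW (↥(maximalRealSubfield L)) L a)
          (chiSplittingLine L e₁ dV hdV hdV0 (toHeckeCharacter L μ) (isUnitary_toHeckeCharacter L μ)
            ((isOscillatorChar_toHeckeCharacter_iff μ).mpr hμ) (TW (↥(maximalRealSubfield L)) a)
            (isUnit_det_TW (↥(maximalRealSubfield L)) a) (JW (↥(maximalRealSubfield L)) L a) (JW_eq (↥(maximalRealSubfield L)) L a))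
          p (Λ e))) :
    ∃ T : E →L[ℂ] Lp ℂ 2 ν, ∀ e,
      T e = MemLp.toLp _ (memLp_toQuotFun_lineThetaLift L N H e₁ dV hdV hdV0 g hg μ hμ a hρ μW (Λ e) f ν 2) := by
  haveI := compactSpace_quotient_range_toAdelic_JW L a
  -- the transport of the quotients `[U(H)] → [U(diag dV)]`, `[x] ↦ [ιA x]`, as a continuous map
  have hwd : ∀ x y : (adelicGroupData (↥(maximalRealSubfield L)) L (IsCMField.complexConj L) N H).Adelic,
      QuotientGroup.leftRel (adelicGroupData (↥(maximalRealSubfield L)) L (IsCMField.complexConj L) N H).quotientSubgroup x y →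
        (QuotientGroup.mk ((cmAdelicFrameTransport L N H dV g hg) x) :
            ↥(UnitaryGroup.adelic (↥(maximalRealSubfield L)) L (IsCMField.complexConj L) N (Matrix.diagonal dV)) ⧸
              (UnitaryGroup.toAdelic (↥(maximalRealSubfield L)) L (IsCMField.complexConj L) N (Matrix.diagonal dV)).range) =
          QuotientGroup.mk ((cmAdelicFrameTransport L N H dV g hg) y) := by
    intro x y hxy
    rw [QuotientGroup.leftRel_apply] at hxy
    have h' : x⁻¹ * y ∈ (⊥ : Subgroup (adelicGroupData (↥(maximalRealSubfield L)) L (IsCMField.complexConj L) N H).Adelic) ⊔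
        (UnitaryGroup.toAdelic (↥(maximalRealSubfield L)) L (IsCMField.complexConj L) N H).range := hxy
    rw [bot_sup_eq] at h'
    refine QuotientGroup.eq.mpr ?_
    rw [← map_inv, ← map_mul]
    exact cmAdelicFrameTransport_mem_range_toAdelic h'
  let qmap : C((adelicGroupData (↥(maximalRealSubfield L)) L (IsCMField.complexConj L) N H).automorphicQuotient,
      ↥(UnitaryGroup.adelic (↥(maximalRealSubfield L)) L (IsCMField.complexConj L) N (Matrix.diagonal dV)) ⧸
        (UnitaryGroup.toAdelic (↥(maximalRealSubfield L)) L (IsCMField.complexConj L) N (Matrix.diagonal dV)).range) :=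
    ⟨fun q => Quotient.liftOn' q (fun x => (QuotientGroup.mk ((cmAdelicFrameTransport L N H dV g hg) x) :
        ↥(UnitaryGroup.adelic (↥(maximalRealSubfield L)) L (IsCMField.complexConj L) N (Matrix.diagonal dV)) ⧸
          (UnitaryGroup.toAdelic (↥(maximalRealSubfield L)) L (IsCMField.complexConj L) N (Matrix.diagonal dV)).range)) hwd,
      (continuous_quotient_mk'.comp (continuous_cmAdelicFrameTransport L N H dV g hg)).quotient_liftOn' hwd⟩
  -- `e ↦ toQuotFun (Θ̃_{Λ e}(f) ∘ ιA)` as a linear map `E → C([U(H)], ℂ)`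
  let Tq : E →ₗ[ℂ] C((adelicGroupData (↥(maximalRealSubfield L)) L (IsCMField.complexConj L) N H).automorphicQuotient, ℂ) :=
    { toFun := fun e => ⟨toQuotFun (adelicGroupData (↥(maximalRealSubfield L)) L (IsCMField.complexConj L) N H) fun y =>
          (lineThetaKernelDatum L N e₁ dV hdV hdV0 μ hμ a hρ).thetaLiftFun μW (Λ e) f ((cmAdelicFrameTransport L N H dV g hg) y),
        continuous_toQuotFun_lineThetaLift L N H e₁ dV hdV hdV0 g hg μ hμ a hρ μW (Λ e) f⟩
      map_add' := fun x y => ContinuousMap.ext fun q => by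
        simpa [map_add] using
          congrFun (toQuotFun_lineThetaLift_add_left L N H e₁ dV hdV hdV0 g hg μ hμ a hρ μW f (Λ x) (Λ y)) q
      map_smul' := fun r x => ContinuousMap.ext fun q => by
        simpa [map_smul] using
          congrFun (toQuotFun_lineThetaLift_smul_left L N H e₁ dV hdV hdV0 g hg μ hμ a hρ μW f r (Λ x)) q }
  -- it is `e ↦ Θ_{Λ e}(f) ∘ qmap`, hence continuous
  have hTq_eq : ∀ e, Tq e = ((lineThetaKernelDatum L N e₁ dV hdV hdV0 μ hμ a hρ).thetaLift μW (Λ e) f).comp qmap := fun e => by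
    refine ContinuousMap.ext fun q => ?_
    obtain ⟨x, rfl⟩ := QuotientGroup.mk_surjective q
    show toQuotFun (adelicGroupData (↥(maximalRealSubfield L)) L (IsCMField.complexConj L) N H) (fun y =>
        (lineThetaKernelDatum L N e₁ dV hdV hdV0 μ hμ a hρ).thetaLiftFun μW (Λ e) f ((cmAdelicFrameTransport L N H dV g hg) y))
          ((adelicGroupData (↥(maximalRealSubfield L)) L (IsCMField.complexConj L) N H).toAutomorphicQuotient x) =
      (lineThetaKernelDatum L N e₁ dV hdV hdV0 μ hμ a hρ).thetaLift μW (Λ e) f (QuotientGroup.mk ((cmAdelicFrameTransport L N H dV g hg) x))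
    exact toQuotFun_lineThetaLift_mk L N H e₁ dV hdV hdV0 g hg μ hμ a hρ μW (Λ e) f x
  have hTq_cont : Continuous Tq := by
    have h : Continuous fun e => ((lineThetaKernelDatum L N e₁ dV hdV hdV0 μ hμ a hρ).thetaLift μW (Λ e) f).comp qmap :=
      (ContinuousMap.continuous_precomp qmap).comp
        (continuous_thetaLift_lineThetaKernelDatum_of_slot L N e₁ dV hdV hdV0 μ hμ a hρ μW f Λ hΛ)
    exact h.congr fun e => (hTq_eq e).symm
  refine ⟨(ContinuousMap.toLp 2 ν ℂ).comp ⟨Tq, hTq_cont⟩, fun e => ?_⟩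
  show ContinuousMap.toLp (E := ℂ) 2 ν ℂ (Tq e) = _
  rfl

/-- **BRICK T3 (`Fin n′` currency of ★ `pairRep_chiSplittingLine_adelicSingle_tmul_of_box`): `Φ_∞ ↦ [Θ̃_{E(Φ_∞ ⊗ Φ_f)}(f) ∘ ιA]` is a continuous
linear map `𝓢((L⁺ ⊗ ℝ)^{n′}) → L²([U(H)], ν)`** for every finite test function `Φ_f` (`E = piSchwartzBruhatEquiv`).
[cite: Weil1964, Chap. I n° 11 pp. 157–158; Chap. III n° 41, Thm 6 p. 193] [cite: Rudin1991, Thm 2.6] [cite: Liu2021, proof of Prop. 4.13 Case 1 (l. 2137–2141, p. 48)] -/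
theorem exists_clm_toLp_lineThetaLift_tmul (Φf : FinSB (↥(maximalRealSubfield L)) (Fin n')) :
    ∃ T : 𝓢((Fin n' → mixedEmbedding.mixedSpace ↥(maximalRealSubfield L)), ℂ) →L[ℂ] Lp ℂ 2 ν, ∀ φ,
      T φ = MemLp.toLp _ (memLp_toQuotFun_lineThetaLift L N H e₁ dV hdV hdV0 g hg μ hμ a hρ μW
        (piSchwartzBruhatEquiv (↥(maximalRealSubfield L)) (Fin n') (φ ⊗ₜ[ℂ] Φf)) f ν 2) := by
  haveI : BarrelledSpace ℂ 𝓢((Fin n' → mixedEmbedding.mixedSpace ↥(maximalRealSubfield L)), ℂ) :=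
    Literature.Analysis.FunctionSpaces.barrelledSpace_schwartzMap
  exact exists_clm_toLp_lineThetaLift_of_slot L N H e₁ dV hdV hdV0 g hg μ hμ a hρ μW f ν
    ((piSchwartzBruhatEquiv (↥(maximalRealSubfield L)) (Fin n')).toLinearMap ∘ₗ
      (TensorProduct.mk ℂ 𝓢((Fin n' → mixedEmbedding.mixedSpace ↥(maximalRealSubfield L)), ℂ)
        (FinSB (↥(maximalRealSubfield L)) (Fin n'))).flip Φf)
    fun p => continuous_thetaDistLM_comp_tmul_of_isLFContinuous (adelicMpCont.isLFContinuous_omega _) Φf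

/-- **BRICK T3 (reindexed `Fin N × Fin 1` currency of ★ `rightRegular_finAdelicToAdelic_toLp_lineThetaLift_tensor`):
`Φ_∞ ↦ [Θ̃_{R_{e₁} E(Φ_∞ ⊗ Φ_f)}(f) ∘ ιA]` is a continuous linear map `𝓢((L⁺ ⊗ ℝ)^{N × 1}) → L²([U(H)], ν)`** (`R_e (Φ_∞ ⊗ Φ_f) = R_e^∞ Φ_∞ ⊗ R_e^f Φ_f`,
★ `piSBReindex_tmul`, with `R_e^∞ = schwartzReindexCLM` continuous). [cite: Weil1964, Chap. I n° 11 pp. 157–158; Chap. III n° 41, Thm 6 p. 193]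
[cite: Rudin1991, Thm 2.6] [cite: Liu2021, proof of Prop. 4.13 Case 1 (l. 2137–2141, p. 48)] -/
theorem exists_clm_toLp_lineThetaLift_piSBReindex_tmul (Φf : FinSB (↥(maximalRealSubfield L)) (Fin N × Fin 1)) :
    ∃ T : 𝓢(((Fin N × Fin 1) → mixedEmbedding.mixedSpace ↥(maximalRealSubfield L)), ℂ) →L[ℂ] Lp ℂ 2 ν, ∀ φ,
      T φ = MemLp.toLp _ (memLp_toQuotFun_lineThetaLift L N H e₁ dV hdV hdV0 g hg μ hμ a hρ μW
        (piSBReindex (↥(maximalRealSubfield L)) e₁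
          (piSchwartzBruhatEquiv (↥(maximalRealSubfield L)) (Fin N × Fin 1) (φ ⊗ₜ[ℂ] Φf))) f ν 2) := by
  haveI : BarrelledSpace ℂ 𝓢(((Fin N × Fin 1) → mixedEmbedding.mixedSpace ↥(maximalRealSubfield L)), ℂ) :=
    Literature.Analysis.FunctionSpaces.barrelledSpace_schwartzMap
  refine exists_clm_toLp_lineThetaLift_of_slot L N H e₁ dV hdV hdV0 g hg μ hμ a hρ μW f ν
    ((piSBReindex (↥(maximalRealSubfield L)) e₁).toLinearMap ∘ₗ
      (piSchwartzBruhatEquiv (↥(maximalRealSubfield L)) (Fin N × Fin 1)).toLinearMap ∘ₗ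
        (TensorProduct.mk ℂ 𝓢(((Fin N × Fin 1) → mixedEmbedding.mixedSpace ↥(maximalRealSubfield L)), ℂ)
          (FinSB (↥(maximalRealSubfield L)) (Fin N × Fin 1))).flip Φf)
    fun p => ?_
  have h := (continuous_thetaDistLM_comp_tmul_of_isLFContinuous
    (M := (pairRep (↥(maximalRealSubfield L)) L (IsCMField.complexConj L) N 1 e₁ (Matrix.diagonal dV) (JW (↥(maximalRealSubfield L)) L a)
      (chiSplittingLine L e₁ dV hdV hdV0 (toHeckeCharacter L μ) (isUnitary_toHeckeCharacter L μ)
        ((isOscillatorChar_toHeckeCharacter_iff μ).mpr hμ) (TW (↥(maximalRealSubfield L)) a)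
        (isUnit_det_TW (↥(maximalRealSubfield L)) a) (JW (↥(maximalRealSubfield L)) L a) (JW_eq (↥(maximalRealSubfield L)) L a)) p :
        piSchwartzBruhat (↥(maximalRealSubfield L)) (Fin n') →ₗ[ℂ] piSchwartzBruhat (↥(maximalRealSubfield L)) (Fin n')))
    (adelicMpCont.isLFContinuous_omega _) (finSBReindex (↥(maximalRealSubfield L)) e₁ Φf)).comp
    (schwartzReindexCLM (↥(maximalRealSubfield L)) e₁).continuous
  refine h.congr fun φ => ?_
  simp only [Function.comp_apply, LinearMap.comp_apply, LinearEquiv.coe_toLinearMap, LinearMap.flip_apply, TensorProduct.mk_apply,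
    piSBReindex_tmul]

end Lift

/-! ## §2 Composition with a continuous linear map out of `L²([U(H)], ν)` — the (3′) closer's `T_f = pr_P ∘ (Φ_∞ ↦ [Θ̃ ∘ ιA])` -/

section Comp

variable (L : Type) [Field L] [NumberField L] [IsCMField L] (N : ℕ) (H : Matrix (Fin N) (Fin N) L)
  {n' : ℕ} (e₁ : Fin N × Fin 1 ≃ Fin n') (dV : Fin N → L) (hdV : ∀ i, IsCMField.complexConj L (dV i) = dV i)
  (hdV0 : ∀ i, dV i ≠ 0) (g : GL (Fin N) L)
  (hg : ((g : Matrix (Fin N) (Fin N) L).map (cmConjRingHom L))ᵀ * H * (g : Matrix (Fin N) (Fin N) L) = Matrix.diagonal dV)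
  (μ : Literature.NumberTheory.Automorphic.IdeleClassGroup L →ₜ* Circle) (hμ : IsConjugateSymplectic L μ) (a : (↥(maximalRealSubfield L))ˣ)
  (hρ : HasThetaMajorants fun
      (p : ↥(UnitaryGroup.adelic (↥(maximalRealSubfield L)) L (IsCMField.complexConj L) N (Matrix.diagonal dV)) × ↥(UnitaryGroup.adelic (↥(maximalRealSubfield L)) L (IsCMField.complexConj L) 1 (JW (↥(maximalRealSubfield L)) L a))) (Φ : piSchwartzBruhat (↥(maximalRealSubfield L)) (Fin n')) =>
        pairRep (↥(maximalRealSubfield L)) L (IsCMField.complexConj L) N 1 e₁ (Matrix.diagonal dV) (JW (↥(maximalRealSubfield L)) L a)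
          (chiSplittingLine L e₁ dV hdV hdV0 (toHeckeCharacter L μ) (isUnitary_toHeckeCharacter L μ)
            ((isOscillatorChar_toHeckeCharacter_iff μ).mpr hμ) (TW (↥(maximalRealSubfield L)) a)
            (isUnit_det_TW (↥(maximalRealSubfield L)) a) (JW (↥(maximalRealSubfield L)) L a) (JW_eq (↥(maximalRealSubfield L)) L a))
          p Φ)
  [CompactSpace (↥(UnitaryGroup.adelic (↥(maximalRealSubfield L)) L (IsCMField.complexConj L) N (Matrix.diagonal dV)) ⧸ (UnitaryGroup.toAdelic (↥(maximalRealSubfield L)) L (IsCMField.complexConj L) N (Matrix.diagonal dV)).range)] [MeasurableSpace (↥(UnitaryGroup.adelic (↥(maximalRealSubfield L)) L (IsCMField.complexConj L) 1 (JW (↥(maximalRealSubfield L)) L a)) ⧸ (UnitaryGroup.toAdelic (↥(maximalRealSubfield L)) L (IsCMField.complexConj L) 1 (JW (↥(maximalRealSubfield L)) L a)).range)] (μW : Measure (↥(UnitaryGroup.adelic (↥(maximalRealSubfield L)) L (IsCMField.complexConj L) 1 (JW (↥(maximalRealSubfield L)) L a)) ⧸ (UnitaryGroup.toAdelic (↥(maximalRealSubfield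 L)) L (IsCMField.complexConj L) 1 (JW (↥(maximalRealSubfield L)) L a)).range))
  (f : C((↥(UnitaryGroup.adelic (↥(maximalRealSubfield L)) L (IsCMField.complexConj L) 1 (JW (↥(maximalRealSubfield L)) L a)) ⧸ (UnitaryGroup.toAdelic (↥(maximalRealSubfield L)) L (IsCMField.complexConj L) 1 (JW (↥(maximalRealSubfield L)) L a)).range), ℂ))
  [BorelSpace (↥(UnitaryGroup.adelic (↥(maximalRealSubfield L)) L (IsCMField.complexConj L) 1 (JW (↥(maximalRealSubfield L)) L a)) ⧸ (UnitaryGroup.toAdelic (↥(maximalRealSubfield L)) L (IsCMField.complexConj L) 1 (JW (↥(maximalRealSubfield L)) L a)).range)] [IsFiniteMeasure μW]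
  [CompactSpace (adelicGroupData (↥(maximalRealSubfield L)) L (IsCMField.complexConj L) N H).automorphicQuotient]
  (ν : Measure (adelicGroupData (↥(maximalRealSubfield L)) L (IsCMField.complexConj L) N H).automorphicQuotient) [IsFiniteMeasure ν]
  {X : Type*} [NormedAddCommGroup X] [NormedSpace ℂ X] (S : Lp ℂ 2 ν →L[ℂ] X)

/-- **`Φ_∞ ↦ S [Θ̃_{E(Φ_∞ ⊗ Φ_f)}(f) ∘ ιA]` is a continuous linear map** for every continuous linear `S` out of `L²([U(H)], ν)` — at
`S := pr_P = P.space.toSubmodule.starProjection` this is brick T3 of the (3′) closer verbatim (`Fin n′` currency).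
[cite: Weil1964, Chap. III n° 41, Thm 6 p. 193] [cite: Rudin1991, Thm 2.6] [cite: Liu2021, proof of Prop. 4.13 Case 1 (l. 2137–2141, p. 48); App. D Lem. D.2 (1)] -/
theorem exists_clm_comp_toLp_lineThetaLift_tmul (Φf : FinSB (↥(maximalRealSubfield L)) (Fin n')) :
    ∃ T : 𝓢((Fin n' → mixedEmbedding.mixedSpace ↥(maximalRealSubfield L)), ℂ) →L[ℂ] X, ∀ φ,
      T φ = S (MemLp.toLp _ (memLp_toQuotFun_lineThetaLift L N H e₁ dV hdV hdV0 g hg μ hμ a hρ μW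
        (piSchwartzBruhatEquiv (↥(maximalRealSubfield L)) (Fin n') (φ ⊗ₜ[ℂ] Φf)) f ν 2)) := by
  obtain ⟨T, hT⟩ := exists_clm_toLp_lineThetaLift_tmul L N H e₁ dV hdV hdV0 g hg μ hμ a hρ μW f ν Φf
  exact ⟨S.comp T, fun φ => by rw [ContinuousLinearMap.comp_apply, hT]⟩

/-- **`Φ_∞ ↦ S [Θ̃_{R_{e₁} E(Φ_∞ ⊗ Φ_f)}(f) ∘ ιA]` is a continuous linear map** for every continuous linear `S` out of `L²([U(H)], ν)`
(reindexed `Fin N × Fin 1` currency; `S := pr_P` is brick T3 of the (3′) closer).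
[cite: Weil1964, Chap. III n° 41, Thm 6 p. 193] [cite: Rudin1991, Thm 2.6] [cite: Liu2021, proof of Prop. 4.13 Case 1 (l. 2137–2141, p. 48); App. D Lem. D.2 (1)] -/
theorem exists_clm_comp_toLp_lineThetaLift_piSBReindex_tmul (Φf : FinSB (↥(maximalRealSubfield L)) (Fin N × Fin 1)) :
    ∃ T : 𝓢(((Fin N × Fin 1) → mixedEmbedding.mixedSpace ↥(maximalRealSubfield L)), ℂ) →L[ℂ] X, ∀ φ,
      T φ = S (MemLp.toLp _ (memLp_toQuotFun_lineThetaLift L N H e₁ dV hdV hdV0 g hg μ hμ a hρ μW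
        (piSBReindex (↥(maximalRealSubfield L)) e₁
          (piSchwartzBruhatEquiv (↥(maximalRealSubfield L)) (Fin N × Fin 1) (φ ⊗ₜ[ℂ] Φf))) f ν 2)) := by
  obtain ⟨T, hT⟩ := exists_clm_toLp_lineThetaLift_piSBReindex_tmul L N H e₁ dV hdV hdV0 g hg μ hμ a hρ μW f ν Φf
  exact ⟨S.comp T, fun φ => by rw [ContinuousLinearMap.comp_apply, hT]⟩

end Comp

end Literature.NumberTheory.Automorphic.Liu2021

end
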